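import Literature.MathematicalPhysics.QuantumFieldTheory.Balaban1983to89.T3UnitScaleTilt
import HarnessLib

/-!
# The level-shift bootstrap, part 1: real-analysis skeleton — helper toward `LevelShiftBootstrap.HistoryTailOfLocalStability`
# (stmt-QuantumFields-26949), route-independent (no `Theses` import); width seat `ym-line-sfw-p2-w3` g22, `--supports` 26949

§1 `chain_bound`: one-step bounds `a_{J+1} ≤ e^{ρ_J}a_J/(1 − c_J) + c'_{J+1}` (`ρ ≥ 0`, `0 ≤ c_J ≤ ½`, `c', a ≥ 0`) give
`a_K ≤ exp(Σ_{m≤J<K}(ρ_J + 2c_J))·(a_m + Σ_{m<J≤K} c'_J)` (the cross-ratio chain in scalar form; `1/(1−x) ≤ e^{2x}` on `[0,½]`).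
§2 Geometric bookkeeping: `¼`-dominated sequences have block sums `≤ (4/3)·(first term)`; the free top fraction costs a factor `m`
(`Σ_{J<N} T(⌊J/m⌋) ≤ m·Σ T`).  §3 Growth: with `x_h = x₀ + δh` (`x₀ ≥ 1`, `δ > 0`), `p_h = b₀x_h^P`, `R_h = R·p_h·(m_F+h+1)^q`, `P ≥ q+2`,
every affine-plus-`R` cost is eventually below the INCREMENT `a(p_{h+1}² − p_h²)` (`eventually_le_sq_sub_sq`) and the LEVEL `(a/2)p_h²`
(`eventually_le_half_sq`).  §4 `pFun_sqrt_eq`: at a natural exponent, `p(√(γL^{-h})) = b₀(1 − ½log γ + ½(log L)h)^P` — Bałaban's profile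
along the depth IS of the form of §3.  Bookkeeping only: no estimate of Bałaban's is asserted, the crux `LocalUnitStabilityL` (27016) is
untouched, rung R3 is a RECORD rung — no summit, no Clay claim; the Yang–Mills mass gap is NOT proved by any of this.  No `def`, no `sorry`.
References: T. Bałaban, CMP **102** (1985) 255–275 [Balaban1985UV3] ((3) p.256, (7) p.257); C. King, CMP **102** (1986) 649–677 [King1986] ((3.12) p.657).
-/

set_option autoImplicit false

noncomputable section

open scoped BigOperators

namespace Summit.QuantumFields.YangMills.Theorems.HistoryTailOfLocalStability

open Literature.MathematicalPhysics.QuantumFieldTheory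
open Literature.MathematicalPhysics.QuantumFieldTheory.Balaban1983to89

/-! ## §1 The scalar chain -/

section Chain

/-- `1/(1 − x) ≤ e^{2x}` for `0 ≤ x ≤ ½`, in the product form `1 ≤ (1 − x)·e^{2x}`. [folklore] -/
theorem one_le_one_sub_mul_exp_two_mul {x : ℝ} (hx0 : 0 ≤ x) (hx : x ≤ 1 / 2) : 1 ≤ (1 - x) * Real.exp (2 * x) := by
  have h1 : 2 * x + 1 ≤ Real.exp (2 * x) := Real.add_one_le_exp _
  have h2 : 1 ≤ (1 - x) * (2 * x + 1) := by nlinarith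
  exact h2.trans (mul_le_mul_of_nonneg_left h1 (by linarith))

/-- Division form: `y/(1 − x) ≤ e^{2x}·y` for `0 ≤ x ≤ ½`, `0 ≤ y`. [folklore] -/
theorem div_one_sub_le_exp_mul {x y : ℝ} (hx0 : 0 ≤ x) (hx : x ≤ 1 / 2) (hy : 0 ≤ y) :
    y / (1 - x) ≤ Real.exp (2 * x) * y := by
  have hpos : 0 < 1 - x := by linarith
  rw [div_le_iff₀ hpos]
  have := one_le_one_sub_mul_exp_two_mul hx0 hx
  calc y = 1 * y := (one_mul y).symm
    _ ≤ ((1 - x) * Real.exp (2 * x)) * y := mul_le_mul_of_nonneg_right this hy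
    _ = Real.exp (2 * x) * y * (1 - x) := by ring

/-- **THE SCALAR CHAIN** of route `LevelShiftBootstrap`: one-step bounds `a_{J+1} ≤ e^{ρ_J}a_J/(1 − c_J) + c'_{J+1}` (`m ≤ J < K`) with
`ρ_J ≥ 0`, `0 ≤ c_J ≤ ½`, `c'_J ≥ 0`, `a ≥ 0` give `a_K ≤ exp(Σ_{J ∈ [m,K)}(ρ_J + 2c_J))·(a_m + Σ_{J ∈ [m+1, K+1)} c'_J)`. [cite: King1986, Thm 3.4 (3.9)-(3.13) p.656] -/
theorem chain_bound {a c c' ρ : ℕ → ℝ} {m : ℕ} (ha : ∀ J, 0 ≤ a J) (hc' : ∀ J, 0 ≤ c' J)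
    (hρ : ∀ J, m ≤ J → 0 ≤ ρ J) (hc0 : ∀ J, m ≤ J → 0 ≤ c J) (hc : ∀ J, m ≤ J → c J ≤ 1 / 2)
    (hstep : ∀ J, m ≤ J → a (J + 1) ≤ Real.exp (ρ J) * a J / (1 - c J) + c' (J + 1)) :
    ∀ K, m ≤ K → a K ≤ Real.exp (∑ J ∈ Finset.Ico m K, (ρ J + 2 * c J)) *
      (a m + ∑ J ∈ Finset.Ico (m + 1) (K + 1), c' J) := by
  intro K hK
  induction K, hK using Nat.le_induction with
  | base => simp
  | succ K hK ih =>
    have hP : 1 ≤ Real.exp (ρ K + 2 * c K) := Real.one_le_exp (by linarith [hρ K hK, hc0 K hK])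
    have hS0 : 0 ≤ a m + ∑ J ∈ Finset.Ico (m + 1) (K + 1), c' J :=
      add_nonneg (ha m) (Finset.sum_nonneg fun J _ => hc' J)
    have hE0 : 0 ≤ Real.exp (∑ J ∈ Finset.Ico m K, (ρ J + 2 * c J)) := (Real.exp_pos _).le
    have h1 : Real.exp (ρ K) * a K / (1 - c K) ≤ Real.exp (ρ K + 2 * c K) * a K := by
      rw [mul_div_assoc, Real.exp_add, mul_assoc]
      exact mul_le_mul_of_nonneg_left (div_one_sub_le_exp_mul (hc0 K hK) (hc K hK) (ha K)) (Real.exp_pos _).le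
    rw [Finset.sum_Ico_succ_top hK, Finset.sum_Ico_succ_top (by omega : m + 1 ≤ K + 1), Real.exp_add]
    calc a (K + 1) ≤ Real.exp (ρ K) * a K / (1 - c K) + c' (K + 1) := hstep K hK
      _ ≤ Real.exp (ρ K + 2 * c K) * a K + c' (K + 1) := by linarith
      _ ≤ Real.exp (ρ K + 2 * c K) * (Real.exp (∑ J ∈ Finset.Ico m K, (ρ J + 2 * c J)) *
            (a m + ∑ J ∈ Finset.Ico (m + 1) (K + 1), c' J)) + c' (K + 1) := by
          gcongr
      _ ≤ Real.exp (ρ K + 2 * c K) * (Real.exp (∑ J ∈ Finset.Ico m K, (ρ J + 2 * c J)) *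
            (a m + ∑ J ∈ Finset.Ico (m + 1) (K + 1), c' J)) +
            (Real.exp (ρ K + 2 * c K) * Real.exp (∑ J ∈ Finset.Ico m K, (ρ J + 2 * c J))) * c' (K + 1) := by
          have : 1 * c' (K + 1) ≤ (Real.exp (ρ K + 2 * c K) * Real.exp (∑ J ∈ Finset.Ico m K, (ρ J + 2 * c J))) *
              c' (K + 1) :=
            mul_le_mul_of_nonneg_right (one_le_mul_of_one_le_of_one_le hP (Real.one_le_exp
              (Finset.sum_nonneg fun J hJ => by
                have hJ' := (Finset.mem_Ico.mp hJ).1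
                linarith [hρ J hJ', hc0 J hJ']))) (hc' _)
          linarith
      _ = Real.exp (∑ J ∈ Finset.Ico m K, (ρ J + 2 * c J)) * Real.exp (ρ K + 2 * c K) *
            (a m + (∑ J ∈ Finset.Ico (m + 1) (K + 1), c' J + c' (K + 1))) := by ring

end Chain

/-! ## §2 Geometric bookkeeping -/

section Geometric

/-- A sequence dominated by the ratio `¼` from `n₀` on decays geometrically: `W(n + k) ≤ (¼)^k·W(n)` for `n ≥ n₀`. [folklore] -/
theorem le_quarter_pow_mul {W : ℕ → ℝ} {n₀ : ℕ} (hW : ∀ k, n₀ ≤ k → W (k + 1) ≤ W k / 4) {n : ℕ} (hn : n₀ ≤ n) :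
    ∀ k, W (n + k) ≤ ((1 : ℝ) / 4) ^ k * W n
  | 0 => by simp
  | k + 1 => by
    have ih := le_quarter_pow_mul hW hn k
    calc W (n + (k + 1)) = W (n + k + 1) := by rw [Nat.add_assoc]
      _ ≤ W (n + k) / 4 := hW _ (by omega)
      _ ≤ (((1 : ℝ) / 4) ^ k * W n) / 4 := by gcongr
      _ = ((1 : ℝ) / 4) ^ (k + 1) * W n := by rw [pow_succ]; ring

/-- Block sums of a `¼`-dominated non-negative sequence: `Σ_{i ∈ [n, N]} W(i) ≤ (4/3)·W(n)` for `n ≥ n₀`. [folklore] -/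
theorem sum_Icc_le_of_quarter {W : ℕ → ℝ} {n₀ : ℕ} (hW0 : ∀ k, 0 ≤ W k) (hW : ∀ k, n₀ ≤ k → W (k + 1) ≤ W k / 4)
    {n : ℕ} (hn : n₀ ≤ n) (N : ℕ) : ∑ i ∈ Finset.Icc n N, W i ≤ 4 / 3 * W n := by
  have hgeom : Summable (fun k : ℕ => ((1 : ℝ) / 4) ^ k) := summable_geometric_of_lt_one (by norm_num) (by norm_num)
  have htsum : ∑' k : ℕ, ((1 : ℝ) / 4) ^ k = 4 / 3 := by
    rw [tsum_geometric_of_lt_one (by norm_num) (by norm_num)]; norm_num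
  by_cases hnN : n ≤ N
  · -- reindex `i = n + k`, `k < N − n + 1`
    have hset : Finset.Icc n N = Finset.image (fun k => n + k) (Finset.range (N - n + 1)) := by
      ext i
      simp only [Finset.mem_Icc, Finset.mem_image, Finset.mem_range]
      constructor
      · intro hi; exact ⟨i - n, by omega, by omega⟩
      · rintro ⟨k, hk, rfl⟩; omega
    have hinj : Set.InjOn (fun k => n + k) (Finset.range (N - n + 1) : Set ℕ) := fun x _ y _ h => by simpa using h
    rw [hset, Finset.sum_image hinj]
    calc ∑ k ∈ Finset.range (N - n + 1), W (n + k) ≤ ∑ k ∈ Finset.range (N - n + 1), ((1 : ℝ) / 4) ^ k * W n :=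
          Finset.sum_le_sum fun k _ => le_quarter_pow_mul hW hn k
      _ = (∑ k ∈ Finset.range (N - n + 1), ((1 : ℝ) / 4) ^ k) * W n := by rw [Finset.sum_mul]
      _ ≤ (∑' k : ℕ, ((1 : ℝ) / 4) ^ k) * W n :=
          mul_le_mul_of_nonneg_right (hgeom.sum_le_tsum _ fun k _ => by positivity) (hW0 n)
      _ = 4 / 3 * W n := by rw [htsum]
  · rw [Finset.Icc_eq_empty (by omega), Finset.sum_empty]
    have := hW0 n
    positivity

/-- `Σ_{K < mM} T(⌊K/m⌋) = m·Σ_{n < M} T(n)`. [folklore] -/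
theorem sum_range_mul_comp_div (T : ℕ → ℝ) {m : ℕ} (hm : 0 < m) :
    ∀ M : ℕ, ∑ K ∈ Finset.range (m * M), T (K / m) = m * ∑ n ∈ Finset.range M, T n
  | 0 => by simp
  | M + 1 => by
    rw [Nat.mul_succ, Finset.sum_range_add, sum_range_mul_comp_div T hm M, Finset.sum_range_succ, mul_add]
    congr 1
    have h : ∀ t ∈ Finset.range m, T ((m * M + t) / m) = T M := fun t ht => by
      rw [Nat.mul_add_div hm, Nat.div_eq_of_lt (Finset.mem_range.mp ht), add_zero]
    rw [Finset.sum_congr rfl h, Finset.sum_const, Finset.card_range, nsmul_eq_mul]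

/-- **THE FREE TOP FRACTION COSTS A FACTOR `m`** (partial-sum form): `Σ_{K<N} T(⌊K/m⌋) ≤ m·Σ_n T(n)` for `T ≥ 0` summable, `m ≥ 1`.
[cite: King1986, (3.12) p.657] -/
theorem sum_range_comp_div_le {T : ℕ → ℝ} (hT0 : ∀ n, 0 ≤ T n) (hT : Summable T) {m : ℕ} (hm : 0 < m) (N : ℕ) :
    ∑ K ∈ Finset.range N, T (K / m) ≤ m * ∑' n, T n := by
  have hsub : Finset.range N ⊆ Finset.range (m * (N / m + 1)) := fun K hK =>
    Finset.mem_range.mpr ((Finset.mem_range.mp hK).trans (Nat.lt_mul_div_succ N hm))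
  calc ∑ K ∈ Finset.range N, T (K / m)
      ≤ ∑ K ∈ Finset.range (m * (N / m + 1)), T (K / m) :=
        Finset.sum_le_sum_of_subset_of_nonneg hsub fun K _ _ => hT0 _
    _ = m * ∑ n ∈ Finset.range (N / m + 1), T n := sum_range_mul_comp_div T hm _
    _ ≤ m * ∑' n, T n :=
        mul_le_mul_of_nonneg_left (hT.sum_le_tsum _ fun n _ => hT0 n) (Nat.cast_nonneg _)

/-- The instance used by the bootstrap: `Σ_{J<N} (¼)^{⌊J/m⌋} ≤ (4/3)·m`. [folklore] -/
theorem sum_range_quarter_pow_div_le {m : ℕ} (hm : 0 < m) (N : ℕ) :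
    ∑ J ∈ Finset.range N, ((1 : ℝ) / 4) ^ (J / m) ≤ 4 / 3 * m := by
  have hgeom : Summable (fun k : ℕ => ((1 : ℝ) / 4) ^ k) := summable_geometric_of_lt_one (by norm_num) (by norm_num)
  have htsum : ∑' k : ℕ, ((1 : ℝ) / 4) ^ k = 4 / 3 := by
    rw [tsum_geometric_of_lt_one (by norm_num) (by norm_num)]; norm_num
  calc ∑ J ∈ Finset.range N, ((1 : ℝ) / 4) ^ (J / m) ≤ m * ∑' k : ℕ, ((1 : ℝ) / 4) ^ k :=
        sum_range_comp_div_le (fun n => by positivity) hgeom hm N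
    _ = 4 / 3 * m := by rw [htsum]; ring

/-- Restriction of the previous bound to a window `[A, B)` inside `[0, N)`. [folklore] -/
theorem sum_Ico_quarter_pow_div_le {m : ℕ} (hm : 0 < m) (A B : ℕ) :
    ∑ J ∈ Finset.Ico A B, ((1 : ℝ) / 4) ^ (J / m) ≤ 4 / 3 * m :=
  calc ∑ J ∈ Finset.Ico A B, ((1 : ℝ) / 4) ^ (J / m) ≤ ∑ J ∈ Finset.range B, ((1 : ℝ) / 4) ^ (J / m) :=
        Finset.sum_le_sum_of_subset_of_nonneg (fun J hJ => by
          rw [Finset.mem_Ico] at hJ; exact Finset.mem_range.mpr hJ.2) fun J _ _ => by positivity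
    _ ≤ 4 / 3 * m := sum_range_quarter_pow_div_le hm B

end Geometric

/-! ## §3 Growth of the profile along the refinement depth -/

section Growth

/-- Binomial lower bound: `x^{n+1} + (n+1)·δ·x^n ≤ (x + δ)^{n+1}` for `x, δ ≥ 0`. [folklore] -/
theorem pow_add_mul_le_add_pow {x δ : ℝ} (hx : 0 ≤ x) (hδ : 0 ≤ δ) :
    ∀ n : ℕ, x ^ (n + 1) + (n + 1) * δ * x ^ n ≤ (x + δ) ^ (n + 1)
  | 0 => by simp
  | n + 1 => by
    have ih := pow_add_mul_le_add_pow hx hδ n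
    have hxd : 0 ≤ x + δ := add_nonneg hx hδ
    calc x ^ (n + 1 + 1) + (↑(n + 1) + 1) * δ * x ^ (n + 1)
        ≤ x ^ (n + 1 + 1) + (↑(n + 1) + 1) * δ * x ^ (n + 1) + (n + 1) * δ ^ 2 * x ^ n := by
          have : 0 ≤ (n + 1 : ℝ) * δ ^ 2 * x ^ n := by positivity
          linarith
      _ = (x + δ) * (x ^ (n + 1) + (n + 1) * δ * x ^ n) := by push_cast; ring
      _ ≤ (x + δ) * (x + δ) ^ (n + 1) := mul_le_mul_of_nonneg_left ih hxd
      _ = (x + δ) ^ (n + 1 + 1) := by ring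

/-- Increment of an even power along a step `δ ≥ 0`: `δ·x^{2P−1} ≤ (x + δ)^{2P} − x^{2P}` (`P ≥ 1`, `x ≥ 0`). [folklore] -/
theorem mul_pow_le_pow_sub_pow {x δ : ℝ} (hx : 0 ≤ x) (hδ : 0 ≤ δ) {P : ℕ} (hP : 1 ≤ P) :
    δ * x ^ (2 * P - 1) ≤ (x + δ) ^ (2 * P) - x ^ (2 * P) := by
  obtain ⟨n, hn⟩ : ∃ n, 2 * P = n + 1 := ⟨2 * P - 1, by omega⟩
  have hn' : 2 * P - 1 = n := by omega
  rw [hn', hn]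
  have h := pow_add_mul_le_add_pow hx hδ n
  have h2 : δ * x ^ n ≤ (n + 1) * δ * x ^ n := by
    have : 0 ≤ (n : ℝ) * δ * x ^ n := by positivity
    linarith
  linarith

variable {x₀ δ a b₀ R : ℝ} {P q mF : ℕ}

/-- **INCREMENT DOMINATION**: along `x_h = x₀ + δh` (`x₀ ≥ 1`, `δ > 0`) with `p_h = b₀x_h^P`, `R_h = R·p_h·(m_F + h + 1)^q`, `P ≥ q + 2`,
`a, b₀ > 0`, `R ≥ 0`: for all constants `K₁, K₂` eventually `K₁ + K₂·h + R_{h+1} ≤ a·(p_{h+1}² − p_h²)` — the gain of ONE refinement step in the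
exponent of the brute-force tail beats every polynomial cost of lower degree. [cite: Balaban1985UV3, (7) p.257] -/
theorem eventually_le_sq_sub_sq (hx₀ : 1 ≤ x₀) (hδ : 0 < δ) (ha : 0 < a) (hb : 0 < b₀) (hR : 0 ≤ R) (hP : q + 2 ≤ P)
    (K₁ K₂ : ℝ) : ∃ h₀ : ℕ, ∀ h : ℕ, h₀ ≤ h →
      K₁ + K₂ * h + R * (b₀ * (x₀ + δ * (h + 1 : ℕ)) ^ P) * ((mF : ℝ) + (h + 1 : ℕ) + 1) ^ q ≤
        a * ((b₀ * (x₀ + δ * (h + 1 : ℕ)) ^ P) ^ 2 - (b₀ * (x₀ + δ * h) ^ P) ^ 2) := by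
  -- the cost constant
  set κ : ℝ := |K₁| + |K₂| / δ + R * b₀ * ((mF : ℝ) + 1 + 1 / δ) ^ q with hκ
  have hκ0 : 0 ≤ κ := by positivity
  -- threshold: `x_h ≥ δ` and `κ·2^{P+q} ≤ a b₀² δ x_h`
  obtain ⟨h₀, hh₀⟩ : ∃ h₀ : ℕ, (1 : ℝ) ≤ h₀ ∧ κ * 2 ^ (P + q) / (a * b₀ ^ 2 * δ ^ 2) ≤ h₀ := by
    refine ⟨⌈max 1 (κ * 2 ^ (P + q) / (a * b₀ ^ 2 * δ ^ 2))⌉₊, ?_, ?_⟩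
    · exact (le_max_left _ _).trans (Nat.le_ceil _)
    · exact (le_max_right _ _).trans (Nat.le_ceil _)
  refine ⟨h₀, fun h hh => ?_⟩
  have hh' : (h₀ : ℝ) ≤ h := by exact_mod_cast hh
  set x : ℝ := x₀ + δ * h with hxdef
  set y : ℝ := x₀ + δ * (h + 1 : ℕ) with hydef
  have hyx : y = x + δ := by rw [hydef, hxdef]; push_cast; ring
  have hx1 : 1 ≤ x := by rw [hxdef]; nlinarith
  have hx0 : 0 ≤ x := by linarith
  have hy1 : 1 ≤ y := by rw [hyx]; linarith
  have hy0 : 0 ≤ y := by linarith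
  have hxδ : δ ≤ x := by
    rw [hxdef]
    have : δ * 1 ≤ δ * h := mul_le_mul_of_nonneg_left (hh₀.1.trans hh') hδ.le
    linarith
  have hxbig : κ * 2 ^ (P + q) ≤ a * b₀ ^ 2 * δ * x := by
    have h1 : κ * 2 ^ (P + q) / (a * b₀ ^ 2 * δ ^ 2) ≤ h := hh₀.2.trans hh'
    have hden : 0 < a * b₀ ^ 2 * δ ^ 2 := by positivity
    rw [div_le_iff₀ hden] at h1
    rw [hxdef]
    nlinarith [mul_nonneg (mul_nonneg ha.le (sq_nonneg b₀)) hδ.le]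
  -- `h + 1 ≤ y/δ`, `h ≤ y/δ`
  have hh1 : ((h + 1 : ℕ) : ℝ) ≤ y / δ := by
    rw [le_div_iff₀ hδ, hydef]; nlinarith
  have hhy : (h : ℝ) ≤ y / δ := le_trans (by push_cast; linarith) hh1
  -- the cost is `≤ κ·y^{P+q}`
  have hyPq : 1 ≤ y ^ (P + q) := one_le_pow₀ hy1
  have hyle : y ≤ y ^ (P + q) := by
    calc y = y ^ 1 := (pow_one y).symm
      _ ≤ y ^ (P + q) := pow_le_pow_right₀ hy1 (by omega)
  have hcost1 : K₁ ≤ |K₁| * y ^ (P + q) :=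
    (le_abs_self K₁).trans (le_mul_of_one_le_right (abs_nonneg _) hyPq)
  have hcost2 : K₂ * h ≤ |K₂| / δ * y ^ (P + q) := by
    calc K₂ * h ≤ |K₂| * h := mul_le_mul_of_nonneg_right (le_abs_self _) (Nat.cast_nonneg _)
      _ ≤ |K₂| * (y / δ) := mul_le_mul_of_nonneg_left hhy (abs_nonneg _)
      _ = |K₂| / δ * y := by ring
      _ ≤ |K₂| / δ * y ^ (P + q) := mul_le_mul_of_nonneg_left hyle (by positivity)
  have hvol : (mF : ℝ) + (h + 1 : ℕ) + 1 ≤ ((mF : ℝ) + 1 + 1 / δ) * y := by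
    have h1 : (mF : ℝ) + 1 ≤ ((mF : ℝ) + 1) * y := le_mul_of_one_le_right (by positivity) hy1
    have h2 : ((h + 1 : ℕ) : ℝ) ≤ 1 / δ * y := by rw [one_div_mul_eq_div]; exact hh1
    nlinarith
  have hvol0 : 0 ≤ (mF : ℝ) + (h + 1 : ℕ) + 1 := by positivity
  have hcost3 : R * (b₀ * y ^ P) * ((mF : ℝ) + (h + 1 : ℕ) + 1) ^ q ≤
      R * b₀ * ((mF : ℝ) + 1 + 1 / δ) ^ q * y ^ (P + q) := by
    have h1 : ((mF : ℝ) + (h + 1 : ℕ) + 1) ^ q ≤ (((mF : ℝ) + 1 + 1 / δ) * y) ^ q :=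
      pow_le_pow_left₀ hvol0 hvol q
    calc R * (b₀ * y ^ P) * ((mF : ℝ) + (h + 1 : ℕ) + 1) ^ q
        ≤ R * (b₀ * y ^ P) * (((mF : ℝ) + 1 + 1 / δ) * y) ^ q :=
          mul_le_mul_of_nonneg_left h1 (by positivity)
      _ = R * b₀ * ((mF : ℝ) + 1 + 1 / δ) ^ q * y ^ (P + q) := by rw [mul_pow, pow_add]; ring
  have hcost : K₁ + K₂ * h + R * (b₀ * y ^ P) * ((mF : ℝ) + (h + 1 : ℕ) + 1) ^ q ≤ κ * y ^ (P + q) := by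
    rw [hκ]; nlinarith
  -- the gain is `≥ a b₀² δ x^{2P−1} ≥ a b₀² δ x · x^{P+q}`
  have hP1 : 1 ≤ P := by omega
  have hgain : a * b₀ ^ 2 * (δ * x ^ (2 * P - 1)) ≤ a * ((b₀ * y ^ P) ^ 2 - (b₀ * x ^ P) ^ 2) := by
    have h1 := mul_pow_le_pow_sub_pow hx0 hδ.le hP1
    rw [← hyx] at h1
    have h2 : (b₀ * y ^ P) ^ 2 - (b₀ * x ^ P) ^ 2 = b₀ ^ 2 * (y ^ (2 * P) - x ^ (2 * P)) := by ring
    rw [h2]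
    calc a * b₀ ^ 2 * (δ * x ^ (2 * P - 1)) = (a * b₀ ^ 2) * (δ * x ^ (2 * P - 1)) := by ring
      _ ≤ (a * b₀ ^ 2) * (y ^ (2 * P) - x ^ (2 * P)) := mul_le_mul_of_nonneg_left h1 (by positivity)
      _ = a * (b₀ ^ 2 * (y ^ (2 * P) - x ^ (2 * P))) := by ring
  -- compare `κ y^{P+q}` with the gain: `y ≤ 2x`, `x^{2P−1} ≥ x·x^{P+q}`
  have hy2x : y ≤ 2 * x := by rw [hyx]; linarith
  have hyPq2 : y ^ (P + q) ≤ 2 ^ (P + q) * x ^ (P + q) := by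
    rw [← mul_pow]; exact pow_le_pow_left₀ hy0 hy2x _
  have hxpow : x * x ^ (P + q) ≤ x ^ (2 * P - 1) := by
    rw [← pow_succ']
    exact pow_le_pow_right₀ hx1 (by omega)
  calc K₁ + K₂ * h + R * (b₀ * y ^ P) * ((mF : ℝ) + (h + 1 : ℕ) + 1) ^ q ≤ κ * y ^ (P + q) := hcost
    _ ≤ κ * (2 ^ (P + q) * x ^ (P + q)) := mul_le_mul_of_nonneg_left hyPq2 hκ0
    _ = (κ * 2 ^ (P + q)) * x ^ (P + q) := by ring
    _ ≤ (a * b₀ ^ 2 * δ * x) * x ^ (P + q) := mul_le_mul_of_nonneg_right hxbig (by positivity)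
    _ = a * b₀ ^ 2 * (δ * (x * x ^ (P + q))) := by ring
    _ ≤ a * b₀ ^ 2 * (δ * x ^ (2 * P - 1)) := by gcongr
    _ ≤ a * ((b₀ * y ^ P) ^ 2 - (b₀ * x ^ P) ^ 2) := hgain

/-- **LEVEL DOMINATION**: in the same setting, for all constants `K₁, K₂` eventually `K₁ + K₂·h + R_h ≤ (a/2)·p_h²` — the accumulated slack of
the cross-ratio chain and every polynomial prefactor are absorbed into half the Gaussian exponent. [cite: Balaban1985UV3, (7) p.257] -/
theorem eventually_le_half_sq (hx₀ : 1 ≤ x₀) (hδ : 0 < δ) (ha : 0 < a) (hb : 0 < b₀) (hR : 0 ≤ R) (hP : q + 2 ≤ P)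
    (K₁ K₂ : ℝ) : ∃ h₀ : ℕ, ∀ h : ℕ, h₀ ≤ h →
      K₁ + K₂ * h + R * (b₀ * (x₀ + δ * h) ^ P) * ((mF : ℝ) + h + 1) ^ q ≤ a / 2 * (b₀ * (x₀ + δ * h) ^ P) ^ 2 := by
  set κ : ℝ := |K₁| + |K₂| / δ + R * b₀ * ((mF : ℝ) + 1 + 1 / δ) ^ q with hκ
  have hκ0 : 0 ≤ κ := by positivity
  obtain ⟨h₀, hh₀⟩ : ∃ h₀ : ℕ, 2 * κ / (a * b₀ ^ 2 * δ) ≤ h₀ := ⟨⌈2 * κ / (a * b₀ ^ 2 * δ)⌉₊, Nat.le_ceil _⟩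
  refine ⟨h₀, fun h hh => ?_⟩
  have hh' : (h₀ : ℝ) ≤ h := by exact_mod_cast hh
  set x : ℝ := x₀ + δ * h with hxdef
  have hx1 : 1 ≤ x := by rw [hxdef]; nlinarith
  have hx0 : 0 ≤ x := by linarith
  have hxbig : 2 * κ ≤ a * b₀ ^ 2 * x := by
    have h1 : 2 * κ / (a * b₀ ^ 2 * δ) ≤ h := hh₀.trans hh'
    have hden : 0 < a * b₀ ^ 2 * δ := by positivity
    rw [div_le_iff₀ hden] at h1
    rw [hxdef]
    nlinarith [mul_nonneg (mul_nonneg ha.le (sq_nonneg b₀)) (le_trans zero_le_one hx₀)]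
  have hhx : (h : ℝ) ≤ x / δ := by rw [le_div_iff₀ hδ, hxdef]; nlinarith
  have hxPq : 1 ≤ x ^ (P + q) := one_le_pow₀ hx1
  have hxle : x ≤ x ^ (P + q) := by
    calc x = x ^ 1 := (pow_one x).symm
      _ ≤ x ^ (P + q) := pow_le_pow_right₀ hx1 (by omega)
  have hcost1 : K₁ ≤ |K₁| * x ^ (P + q) :=
    (le_abs_self K₁).trans (le_mul_of_one_le_right (abs_nonneg _) hxPq)
  have hcost2 : K₂ * h ≤ |K₂| / δ * x ^ (P + q) := by
    calc K₂ * h ≤ |K₂| * h := mul_le_mul_of_nonneg_right (le_abs_self _) (Nat.cast_nonneg _)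
      _ ≤ |K₂| * (x / δ) := mul_le_mul_of_nonneg_left hhx (abs_nonneg _)
      _ = |K₂| / δ * x := by ring
      _ ≤ |K₂| / δ * x ^ (P + q) := mul_le_mul_of_nonneg_left hxle (by positivity)
  have hvol : (mF : ℝ) + h + 1 ≤ ((mF : ℝ) + 1 + 1 / δ) * x := by
    have h1 : (mF : ℝ) + 1 ≤ ((mF : ℝ) + 1) * x := le_mul_of_one_le_right (by positivity) hx1
    have h2 : (h : ℝ) ≤ 1 / δ * x := by rw [one_div_mul_eq_div]; exact hhx
    nlinarith
  have hvol0 : 0 ≤ (mF : ℝ) + h + 1 := by positivity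
  have hcost3 : R * (b₀ * x ^ P) * ((mF : ℝ) + h + 1) ^ q ≤ R * b₀ * ((mF : ℝ) + 1 + 1 / δ) ^ q * x ^ (P + q) := by
    have h1 : ((mF : ℝ) + h + 1) ^ q ≤ (((mF : ℝ) + 1 + 1 / δ) * x) ^ q := pow_le_pow_left₀ hvol0 hvol q
    calc R * (b₀ * x ^ P) * ((mF : ℝ) + h + 1) ^ q ≤ R * (b₀ * x ^ P) * (((mF : ℝ) + 1 + 1 / δ) * x) ^ q :=
          mul_le_mul_of_nonneg_left h1 (by positivity)
      _ = R * b₀ * ((mF : ℝ) + 1 + 1 / δ) ^ q * x ^ (P + q) := by rw [mul_pow, pow_add]; ring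
  have hcost : K₁ + K₂ * h + R * (b₀ * x ^ P) * ((mF : ℝ) + h + 1) ^ q ≤ κ * x ^ (P + q) := by
    rw [hκ]; nlinarith
  have hxpow : x * x ^ (P + q) ≤ x ^ (2 * P) := by
    rw [← pow_succ']
    exact pow_le_pow_right₀ hx1 (by omega)
  calc K₁ + K₂ * h + R * (b₀ * x ^ P) * ((mF : ℝ) + h + 1) ^ q ≤ κ * x ^ (P + q) := hcost
    _ ≤ (a * b₀ ^ 2 * x / 2) * x ^ (P + q) := mul_le_mul_of_nonneg_right (by linarith) (by positivity)
    _ = a / 2 * b₀ ^ 2 * (x * x ^ (P + q)) := by ring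
    _ ≤ a / 2 * b₀ ^ 2 * x ^ (2 * P) := by gcongr
    _ = a / 2 * (b₀ * x ^ P) ^ 2 := by ring

/-- The profile is non-decreasing along the depth (`x₀ ≥ 0`, `δ ≥ 0`, `b₀ ≥ 0`). [folklore] -/
theorem profile_mono (hx₀ : 0 ≤ x₀) (hδ : 0 ≤ δ) (hb : 0 ≤ b₀) {h h' : ℕ} (hh : h ≤ h') :
    b₀ * (x₀ + δ * h) ^ P ≤ b₀ * (x₀ + δ * h') ^ P := by
  have h1 : x₀ + δ * h ≤ x₀ + δ * h' := by
    have : (h : ℝ) ≤ h' := by exact_mod_cast hh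
    nlinarith
  exact mul_le_mul_of_nonneg_left (pow_le_pow_left₀ (by positivity) h1 P) hb

end Growth

/-! ## §4 Bałaban's profile along the refinement depth is of this form -/

section Profile

/-- **THE PROFILE ALONG THE DEPTH**: at a natural exponent `p₀ = P`,
`p(√(γL^{-h})) = b₀·(1 − ½ log γ + ½ (log L)·h)^P` (`γ > 0`, `L > 0`). [cite: Balaban1985UV3, (3) p.256 and (7) p.257] -/
theorem pFun_sqrt_eq {γ : ℝ} (hγ : 0 < γ) {L : ℕ} (hL : 0 < L) (b₀ : ℝ) (P h : ℕ) :
    B10.pFun b₀ (P : ℝ) (Real.sqrt (γ * ((L : ℝ)⁻¹) ^ h)) =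
      b₀ * (1 - Real.log γ / 2 + Real.log L / 2 * h) ^ P := by
  have hL0 : (0 : ℝ) < L := by exact_mod_cast hL
  have hy : 0 < γ * ((L : ℝ)⁻¹) ^ h := mul_pos hγ (pow_pos (inv_pos.mpr hL0) h)
  unfold B10.pFun
  rw [Real.rpow_natCast, Real.log_inv, Real.log_sqrt hy.le, Real.log_mul hγ.ne' (pow_pos (inv_pos.mpr hL0) h).ne',
    Real.log_pow, Real.log_inv]
  congr 1
  ring

/-- The offset is at least one for `γ ≤ 1`: `1 ≤ 1 − ½ log γ`. [folklore] -/
theorem one_le_offset {γ : ℝ} (hγ : 0 < γ) (hγ1 : γ ≤ 1) : 1 ≤ 1 - Real.log γ / 2 := by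
  have := Real.log_nonpos hγ.le hγ1
  linarith

/-- The step is positive for `L > 1`: `0 < ½ log L`. [folklore] -/
theorem step_pos {L : ℕ} (hL : 1 < L) : 0 < Real.log L / 2 := by
  have : (1 : ℝ) < L := by exact_mod_cast hL
  have := Real.log_pos this
  linarith

/-- The inverse coupling of depth `h` as an exponential: `(γL^{-h})⁻¹ = exp(h·log L − log γ)` (`γ, L > 0`). [cite: Balaban1985UV3, (3) p.256] -/
theorem inv_coupling_eq_exp {γ : ℝ} (hγ : 0 < γ) {L : ℕ} (hL : 0 < L) (h : ℕ) :
    (γ * ((L : ℝ)⁻¹) ^ h)⁻¹ = Real.exp (h * Real.log L - Real.log γ) := by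
  have hL0 : (0 : ℝ) < L := by exact_mod_cast hL
  rw [Real.exp_sub, Real.exp_nat_mul, Real.exp_log hL0, Real.exp_log hγ, inv_pow, mul_inv, inv_inv]
  field_simp

end Profile

end Summit.QuantumFields.YangMills.Theorems.HistoryTailOfLocalStability

end
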